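import Mathlib.Analysis.SpecialFunctions.Pow.Real
import Mathlib.Analysis.SpecificLimits.Basic

/-!
# Route `UnitScaleTilt` — crux K1bR-pr `FluctuationComparisonRegPr` (stmt-QuantumFields-19201), stub `stub_logComparisonRegPr`,
# layer S-B «BUDGET»: King's two-rate error is summable along the free fraction `1/m` for `m ≥ m₀`
# (support file `--supports stmt-QuantumFields-19201`; the stub stays open)

Fleet lead `ym-ust-19201-p2` (gen 0); split card `CARD-19201-logComparison-split.md` (evidence #16 on the item), sub-lemma S-B.
WHAT THIS IS: pure real analysis — the `∃ m₀, ∀ m ≥ m₀` of the registered stub.  The printed two-cut-off comparison ([King1986] Thm 3.4 (3.9)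
p.656) bounds the difference of the effective actions of cut-offs `K` and `K+1` at the comparison height `k = K − n`, `n = ⌊K/m⌋` free top
steps, `η = L^{−n}`, by `C·(L^{−γ′k}·η^{−β} + η^{σ})·|T|`, i.e. in the stub's letters `r_K = C·(a^{⌊K/m⌋}·b^{K−⌊K/m⌋} + c^{⌊K/m⌋})` with
`a = L^{β} ≥ 1 > b = L^{−γ′}`, `c = L^{−σ} < 1`; King chooses the fraction in (3.12)–(3.13) p.657 so that this is summable in `K`.  Here:
`summable_pow_div` (`Σ_K ρ^{⌊K/m⌋} < ∞` for `0 ≤ ρ < 1`, `m ≥ 1`), **`exists_m₀_summable_two_rate`** (`∃ m₀ ≥ 1, ∀ m ≥ m₀,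
Σ_K (a^{⌊K/m⌋} b^{K−⌊K/m⌋} + c^{⌊K/m⌋}) < ∞` for `a ≥ 0`, `0 ≤ b < 1`, `0 ≤ c < 1`; `m₀ = j₀ + 1` with `a·b^{j₀} < 1`, i.e. `m > 1 + β/γ′`), and
its reading with the powers of the block size (`exists_m₀_summable_two_rate_rpow`).

References: C. King, CMP 102 (1986) 649–677 [King1986] (Thm 3.4 (3.9) p.656, (3.12)–(3.13) p.657).
-/

noncomputable section

open Filter Topology

namespace Summit.QuantumFields.YangMills.Theorems.LogComparisonBudget

/-- **GEOMETRIC ALONG THE FREE FRACTION**: `Σ_K ρ^{⌊K/m⌋} < ∞` for `0 ≤ ρ < 1` and `m ≥ 1` (each value of `⌊K/m⌋` is taken `m` times;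
proved by comparison with the geometric series of ratio `ρ′^{1/m}`, `ρ′ = max ρ ½`). [cite: King1986, (3.12)-(3.13) p.657] -/
theorem summable_pow_div {ρ : ℝ} (h0 : 0 ≤ ρ) (h1 : ρ < 1) {m : ℕ} (hm : 0 < m) :
    Summable (fun K : ℕ => ρ ^ (K / m)) := by
  -- a positive majorant `ρ′ ∈ [½, 1)`
  set ρ' : ℝ := max ρ (1 / 2) with hρ'
  have h0' : 0 < ρ' := lt_max_of_lt_right (by norm_num)
  have h1' : ρ' < 1 := max_lt h1 (by norm_num)
  have hle : ∀ K : ℕ, ρ ^ (K / m) ≤ ρ' ^ (K / m) := fun K => pow_le_pow_left₀ h0 (le_max_left _ _) _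
  -- its `m`-th root `θ`, `θ^m = ρ′`, `0 < θ < 1`
  set θ : ℝ := ρ' ^ ((m : ℝ)⁻¹) with hθ
  have hθ0 : 0 < θ := Real.rpow_pos_of_pos h0' _
  have hθm : θ ^ m = ρ' := Real.rpow_inv_natCast_pow h0'.le hm.ne'
  have hθ1 : θ < 1 := by
    by_contra hge
    have hge' : 1 ≤ θ := not_lt.mp hge
    have : (1 : ℝ) ≤ θ ^ m := one_le_pow₀ hge'
    linarith
  -- `ρ′^{⌊K/m⌋} = θ^{m⌊K/m⌋} ≤ θ^{K−(m−1)} ≤ θ^{−(m−1)}·θ^K`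
  have hbound : ∀ K : ℕ, ρ' ^ (K / m) ≤ (θ ^ (m - 1))⁻¹ * θ ^ K := by
    intro K
    have hq : ρ' ^ (K / m) = θ ^ (m * (K / m)) := by rw [pow_mul, hθm]
    rw [hq]
    have hdm := Nat.div_add_mod K m
    have hml := Nat.mod_lt K hm
    have h2 : θ ^ (m * (K / m)) ≤ θ ^ (K - (m - 1)) := pow_le_pow_of_le_one hθ0.le hθ1.le (by omega)
    have h3 : θ ^ (K - (m - 1)) * θ ^ (m - 1) ≤ θ ^ K := by
      rw [← pow_add]
      exact pow_le_pow_of_le_one hθ0.le hθ1.le (by omega)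
    calc θ ^ (m * (K / m)) ≤ θ ^ (K - (m - 1)) := h2
      _ ≤ (θ ^ (m - 1))⁻¹ * θ ^ K := by
          rw [le_inv_mul_iff₀ (pow_pos hθ0 _), mul_comm]
          exact h3
  refine Summable.of_nonneg_of_le (fun K => pow_nonneg h0 _) (fun K => (hle K).trans (hbound K)) ?_
  exact (summable_geometric_of_lt_one hθ0.le hθ1).mul_left _

/-- **KING'S BUDGET**: for `a ≥ 0`, `0 ≤ b < 1`, `0 ≤ c < 1` there is `m₀ ≥ 1` such that for every `m ≥ m₀` the two-rate error
`a^{⌊K/m⌋}·b^{K−⌊K/m⌋} + c^{⌊K/m⌋}` is summable in `K` (`m₀ = j₀ + 1` for any `j₀` with `a·b^{j₀} < 1`: the growth `a` per free step is beaten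
by the decay `b^{m−1}` of the `m − 1` performed steps it buys).  With `a = L^{β}`, `b = L^{−γ′}`: `m > 1 + β/γ′`. [cite: King1986, (3.12)-(3.13) p.657] -/
theorem exists_m₀_summable_two_rate {a b c : ℝ} (ha : 0 ≤ a) (hb0 : 0 ≤ b) (hb1 : b < 1) (hc0 : 0 ≤ c) (hc1 : c < 1) :
    ∃ m₀ : ℕ, 0 < m₀ ∧ ∀ m : ℕ, m₀ ≤ m → Summable (fun K : ℕ => a ^ (K / m) * b ^ (K - K / m) + c ^ (K / m)) := by
  -- `a·b^{j₀} < 1` for some `j₀`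
  obtain ⟨j₀, hj₀⟩ : ∃ j₀ : ℕ, a * b ^ j₀ < 1 := by
    have ht : Tendsto (fun j : ℕ => a * b ^ j) atTop (𝓝 (a * 0)) :=
      (tendsto_pow_atTop_nhds_zero_of_lt_one hb0 hb1).const_mul a
    rw [mul_zero] at ht
    exact (ht.eventually (gt_mem_nhds zero_lt_one)).exists
  refine ⟨j₀ + 1, Nat.succ_pos _, fun m hm => ?_⟩
  have hmpos : 0 < m := by omega
  -- the effective ratio per block of `m` cut-offs
  set ρ : ℝ := a * b ^ (m - 1) with hρ
  have hρ0 : 0 ≤ ρ := mul_nonneg ha (pow_nonneg hb0 _)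
  have hρ1 : ρ < 1 :=
    lt_of_le_of_lt (mul_le_mul_of_nonneg_left (pow_le_pow_of_le_one hb0 hb1.le (by omega)) ha) hj₀
  have hterm : ∀ K : ℕ, a ^ (K / m) * b ^ (K - K / m) ≤ ρ ^ (K / m) := by
    intro K
    have hsplit : (m - 1) * (K / m) + K / m = m * (K / m) := by
      rw [Nat.sub_one_mul, Nat.sub_add_cancel (Nat.le_mul_of_pos_left _ hmpos)]
    have hdiv : m * (K / m) ≤ K := Nat.mul_div_le K m
    have hexp : (m - 1) * (K / m) ≤ K - K / m := by omega
    rw [hρ, mul_pow, ← pow_mul]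
    exact mul_le_mul_of_nonneg_left (pow_le_pow_of_le_one hb0 hb1.le hexp) (pow_nonneg ha _)
  refine Summable.of_nonneg_of_le (fun K => add_nonneg (mul_nonneg (pow_nonneg ha _) (pow_nonneg hb0 _)) (pow_nonneg hc0 _))
    (fun K => add_le_add_left (hterm K) _) ?_
  exact (summable_pow_div hρ0 hρ1 hmpos).add (summable_pow_div hc0 hc1 hmpos)

/-- **THE SAME WITH THE POWERS OF THE BLOCK SIZE**: for `L > 1`, `γ′ > 0`, `σ > 0` and any `β` there is `m₀ ≥ 1` with
`Σ_K ((L^β)^{⌊K/m⌋}·(L^{−γ′})^{K−⌊K/m⌋} + (L^{−σ})^{⌊K/m⌋}) < ∞` for all `m ≥ m₀` — [King1986] (3.9)'s `L^{−γk}(L^kε)^{−β} + (L^kε)^{σ}` with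
`k = K − ⌊K/m⌋`, `L^kε = L^{−⌊K/m⌋}`, summed over the cut-offs. [cite: King1986, Thm 3.4 (3.9) p.656] -/
theorem exists_m₀_summable_two_rate_rpow {L β γ' σ : ℝ} (hL : 1 < L) (hγ' : 0 < γ') (hσ : 0 < σ) :
    ∃ m₀ : ℕ, 0 < m₀ ∧ ∀ m : ℕ, m₀ ≤ m →
      Summable (fun K : ℕ => (L ^ β) ^ (K / m) * (L ^ (-γ')) ^ (K - K / m) + (L ^ (-σ)) ^ (K / m)) :=
  have hL0 : 0 ≤ L := zero_le_one.trans hL.le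
  exists_m₀_summable_two_rate (Real.rpow_nonneg hL0 β) (Real.rpow_nonneg hL0 _)
    (Real.rpow_lt_one_of_one_lt_of_neg hL (neg_lt_zero.mpr hγ')) (Real.rpow_nonneg hL0 _)
    (Real.rpow_lt_one_of_one_lt_of_neg hL (neg_lt_zero.mpr hσ))

/-! ## §2 The remainder clauses of the socket `TwoSidedRepAt` from the PRINTED SIZE of the remainders

[Balaban1985UV3] (41) p.266, last term: `Rm_k = Σ_{j<k} O((Lʲε)^{3+κ₀})|T₁^{(j)}| = O(1)·Σ_{i<k} q^{K−i}·|T_phys|`, `q = L^{−κ₀} ∈ [0,1)` (the interface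
`T3AlphaInputsAC.RmSize D C q` types exactly this shape).  Read at the comparison height `n` (`k = K − n`): `Rm K (K − n) ≤ C·V·(1−q)⁻¹·q^{n}`, geometric
along `n = ⌊K/m⌋` — so the two `Rm`-clauses of `T3LogComparisonSocket.TwoSidedRepAt` (non-negativity; `Σ_K (Rm K ⌊K/m⌋ + Rm (K+1) ⌊K/m⌋) < ∞` for
every `m ≥ 1`, in the height reading `RmH K n := Rm K (K − n)`) follow from the printed size alone (`summable_pow_div`). -/

/-- `Σ_{i<j} q^{K−i} ≤ q^{K−j}·(1−q)⁻¹` for `j ≤ K`, `0 ≤ q < 1` (the geometric tail of the printed remainder sum). [cite: Balaban1985UV3, (41) p.266] -/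
theorem sum_pow_sub_le {q : ℝ} (hq0 : 0 ≤ q) (hq1 : q < 1) {K j : ℕ} (hj : j ≤ K) :
    ∑ i ∈ Finset.range j, q ^ (K - i) ≤ q ^ (K - j) * (1 - q)⁻¹ := by
  have hle : ∀ i ∈ Finset.range j, q ^ (K - i) ≤ q ^ (K - j) * q ^ (j - 1 - i) := by
    intro i hi
    have hij := Finset.mem_range.mp hi
    rw [← pow_add]
    exact pow_le_pow_of_le_one hq0 hq1.le (by omega)
  calc ∑ i ∈ Finset.range j, q ^ (K - i) ≤ ∑ i ∈ Finset.range j, q ^ (K - j) * q ^ (j - 1 - i) := Finset.sum_le_sum hle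
    _ = q ^ (K - j) * ∑ i ∈ Finset.range j, q ^ (j - 1 - i) := by rw [Finset.mul_sum]
    _ = q ^ (K - j) * ∑ i ∈ Finset.range j, q ^ i := by rw [Finset.sum_range_reflect (fun i => q ^ i) j]
    _ ≤ q ^ (K - j) * (1 - q)⁻¹ := by
        gcongr
        exact sum_le_hasSum (Finset.range j) (fun n _ => pow_nonneg hq0 n) (hasSum_geometric_of_lt_one hq0 hq1)

/-- **THE `Rm`-CLAUSES OF `TwoSidedRepAt` FROM THE PRINTED SIZE**: if `0 ≤ Rm K j ≤ C·(Σ_{i<j} q^{K−i})·V` for `j ≤ K` (`0 ≤ q < 1`, `0 ≤ V`: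
[Balaban1985UV3] (41) last term with `V = (2L^{F.m})³`), then the height reading `RmH K n := Rm K (K − n)` is non-negative and
`Σ_K (RmH K ⌊K/m⌋ + RmH (K+1) ⌊K/m⌋) < ∞` for every `m ≥ 1` (both terms `≤ |C|·V·(1−q)⁻¹·q^{⌊K/m⌋}`). [cite: Balaban1985UV3, (41) p.266] -/
theorem rmH_clauses_of_size {Rm : ℕ → ℕ → ℝ} {C q V : ℝ} (hq0 : 0 ≤ q) (hq1 : q < 1) (hV : 0 ≤ V)
    (h : ∀ K j : ℕ, j ≤ K → 0 ≤ Rm K j ∧ Rm K j ≤ C * (∑ i ∈ Finset.range j, q ^ (K - i)) * V) :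
    (∀ K n : ℕ, 0 ≤ Rm K (K - n)) ∧
      ∀ m : ℕ, 0 < m → Summable fun K : ℕ => Rm K (K - K / m) + Rm (K + 1) (K + 1 - K / m) := by
  refine ⟨fun K n => (h K (K - n) (Nat.sub_le K n)).1, fun m hm => ?_⟩
  have h1q : 0 < 1 - q := by linarith
  -- the common geometric majorant `B·q^{⌊K/m⌋}`
  set B : ℝ := |C| * (1 - q)⁻¹ * V with hB
  have hB0 : 0 ≤ B := by positivity
  have hbound : ∀ K j : ℕ, j ≤ K → Rm K j ≤ B * q ^ (K - j) := by
    intro K j hj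
    have hS0 : 0 ≤ ∑ i ∈ Finset.range j, q ^ (K - i) := Finset.sum_nonneg fun i _ => pow_nonneg hq0 _
    calc Rm K j ≤ C * (∑ i ∈ Finset.range j, q ^ (K - i)) * V := (h K j hj).2
      _ ≤ |C| * (∑ i ∈ Finset.range j, q ^ (K - i)) * V := by gcongr; exact le_abs_self C
      _ ≤ |C| * (q ^ (K - j) * (1 - q)⁻¹) * V := by gcongr; exact sum_pow_sub_le hq0 hq1 hj
      _ = B * q ^ (K - j) := by rw [hB]; ring
  have hK : ∀ K : ℕ, Rm K (K - K / m) ≤ B * q ^ (K / m) := fun K => by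
    obtain ⟨d, hd, hdl⟩ : ∃ d : ℕ, d = K / m ∧ d ≤ K := ⟨K / m, rfl, Nat.div_le_self K m⟩
    rw [← hd]
    have := hbound K (K - d) (Nat.sub_le _ _)
    rwa [show K - (K - d) = d by omega] at this
  have hK1 : ∀ K : ℕ, Rm (K + 1) (K + 1 - K / m) ≤ B * q ^ (K / m) := fun K => by
    obtain ⟨d, hd, hdl⟩ : ∃ d : ℕ, d = K / m ∧ d ≤ K := ⟨K / m, rfl, Nat.div_le_self K m⟩
    rw [← hd]
    have := hbound (K + 1) (K + 1 - d) (Nat.sub_le _ _)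
    rwa [show K + 1 - (K + 1 - d) = d by omega] at this
  refine Summable.of_nonneg_of_le
    (fun K => add_nonneg (h K _ (Nat.sub_le _ _)).1 (h (K + 1) _ (Nat.sub_le _ _)).1)
    (fun K => add_le_add (hK K) (hK1 K)) ?_
  have hg := (summable_pow_div hq0 hq1 hm).mul_left B
  exact hg.add hg

end Summit.QuantumFields.YangMills.Theorems.LogComparisonBudget

end
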